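import Summits.HodgeConjecture.CorCM.PointwiseConjugationCompositum
import HarnessLib

/-!
# Pointwise partial conjugations, the degree form: `[x(K_a)·y₀(K_b) : ℚ] ∈ {1, 2} · [x(K_a)·y₀(K_b⁺) : ℚ]`, and the
# common constituents of two CM slots are decided by which case occurs

COR-CM (cell `pub-hodgecm2`, binder seat `b16` gen 48, count-neutral claim PTCONJ, file F4 — Galois theory in `ℂ`;
theorems only, no definition, no named fact, no `sorry`).  NEW as stated, hence under `Summits/`.  HONEST FRAMING: a
field-theoretic criterion and its consequences for NAMED classes of CM abelian varieties; `HC_CM` is neither used nor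
asserted.

Sequel of `PointwiseConjugationCompositum` (this seat): there, for CM fields `K_a`, `K_b` and embeddings `x`, `y₀`, a
pointwise partial conjugation (`σ ∈ Aut(ℂ)` with `σ ∘ x = x̄`, `σ ∘ y₀ = y₀`) exists iff `N ⊄ M · N⁺`
(`M = x(K_a)`, `N = y₀(K_b)`, `N⁺ = y₀(K_b⁺)`).  Here the same dichotomy is expressed by DEGREES, the form in which a
census seat checks it:

> **Theorem** (`finrank_compositum_eq_or`, `exists_conj_smul_iff_finrank_eq_two_mul`).  Always
> `[M N : ℚ] = [M N⁺ : ℚ]` or `[M N : ℚ] = 2 · [M N⁺ : ℚ]`; and `∃ σ, σ ∘ x = x̄ ∧ σ ∘ y₀ = y₀` **iff**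
> `[M N : ℚ] = 2 · [M N⁺ : ℚ]`, i.e. iff `[x(K_a) y₀(K_b) : x(K_a) y₀(K_b⁺)] = 2`.

Hence (`pairwise_iff_forall_finrank_eq_two_mul`): for NONDEGENERATE types the slots `Hom(K_a, ℂ)`, `Hom(K_b, ℂ)` have
no common constituent iff `[x(K_a) y₀(K_b) : ℚ] = 2 [x(K_a) y₀(K_b⁺) : ℚ]` for every conjugate `x(K_a)`; summing over
the conjugates, iff `dim_ℚ`-counting gives `K_a ⊗ K_b` and `K_a ⊗ K_b⁺` the same number of simple factors.  And for ALL
types, the degree condition gives additivity `Hg(A_a × A_b) = Hg(A_a) × Hg(A_b)` and, for nondegenerate realisations,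
the Hodge conjecture with `B• = D•` on every `A_a^m × A_b^n` (`hodgeConjectureFor_prod_pair_of_forall_finrank_eq_two_mul`).

ALSO (`exists_conj_smul_of_lt_two_mul_finrank_sup`, `hodgeConjectureFor_prod_pair_of_forall_lt_two_mul_finrank_sup`):
a LARGE compositum, `[x(K_a) y₀(K_b) : ℚ] > [K_a : ℚ][K_b : ℚ]/2`, forces the second case — linear disjointness
(`= [K_a : ℚ][K_b : ℚ]`) is only the extreme instance; and the family forms
`isNondegenerateFamily_iff_of_forall_finrank_eq_two_mul`, `hodgeConjectureFor_prod_of_forall_finrank_eq_two_mul`.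

PROOF.  With a primitive element `α` of `K_b` and `n = y₀(α)`: `N = ℚ(n)`, `M N = P(n)` for `P = M N⁺ ⊇ N⁺ ∋ n + n̄, n n̄`,
so `[M N : P] = deg minpoly_P(n) ∈ {1, 2}` (`natDegree_minpoly_eq_two_of_add_conj_mem`), `= 1` iff `n ∈ P` iff `N ≤ P`;
the tower law (`IntermediateField.finrank_bot_mul_relfinrank`).

## References

* [Lang2002] S. Lang, *Algebra*, GTM 211, V §1 Prop. 1.2, V §4 Thm. 4.6, VI §1 Thm. 1.12 and Cor. 1.13.
* [Shimura1998] G. Shimura, *Abelian Varieties with Complex Multiplication and Modular Functions*, §18.2 Lemma.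
* [Gordon1999HodgeAVSurvey] B. B. Gordon, *A survey of the Hodge conjecture for abelian varieties*, §3 Theorem (Imai,
  Murty) with proof; 7.5–7.7; 10.10.
-/

noncomputable section

open CategoryTheory CategoryTheory.Limits NumberField NumberField.ComplexEmbedding IntermediateField Polynomial Module
open scoped BigOperators IntermediateField

namespace Summit.HodgeConjecture.CorCM

open Literature.NumberTheory.ComplexMultiplication
open Literature.AlgebraicGeometry.Motives (AbelianVariety CMType)
open Literature.AlgebraicGeometry.HodgeTheory
open Literature.AlgebraicGeometry.ComplexMultiplication (IsCMTypeRealisation)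
open Literature.AlgebraicGeometry.VanGeemen1994 (hodgeClassSpan)
open Literature.AlgebraicGeometry.Pohlmann1968
open Literature.Barriers.HodgeConjecture (divisorClassesSpan)

/-! ## §1 The field lemma: adjoining a quadratic `n` with `n + n̄, n n̄ ∈ P` doubles the degree or does nothing -/

section FieldLemma

/-- **`[P(n) : ℚ] = 2 [P : ℚ]` for `n ∉ P` with `n + n̄, n n̄ ∈ P`** (`P ≤ ℂ` finite over `ℚ`; the minimal polynomial of
`n` over `P` is the quadratic `X² − (n + n̄) X + n n̄`, tower law). [cite: Lang2002, V §1 Prop. 1.2 and Prop. 1.4] -/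
theorem finrank_sup_adjoin_simple_eq_two_mul (P : IntermediateField ℚ ℂ) [FiniteDimensional ℚ P] {n : ℂ}
    (hs : n + starRingEnd ℂ n ∈ P) (hp : n * starRingEnd ℂ n ∈ P) (hn : n ∉ P) :
    finrank ℚ ↥(P ⊔ ℚ⟮n⟯) = 2 * finrank ℚ P := by
  obtain ⟨hint, hdeg, -⟩ := natDegree_minpoly_eq_two_of_add_conj_mem P hs hp hn
  have hQ : P ⊔ ℚ⟮n⟯ = adjoin ℚ ((P : Set ℂ) ∪ {n}) := by rw [adjoin_union, adjoin_self]
  have hPQ : P ≤ adjoin ℚ ((P : Set ℂ) ∪ {n}) := hQ ▸ le_sup_left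
  have hbot : adjoin P (P : Set ℂ) = ⊥ := by
    rw [adjoin_eq_bot_iff]
    intro z hz
    exact IntermediateField.mem_bot.2 ⟨⟨z, hz⟩, rfl⟩
  have hext : extendScalars hPQ = P⟮n⟯ := by
    rw [extendScalars_adjoin hPQ, adjoin_union, hbot, bot_sup_eq]
  have h1 := finrank_bot_mul_relfinrank hPQ
  rw [relfinrank_eq_finrank_of_le hPQ, hext, adjoin.finrank hint, hdeg, ← hQ] at h1
  omega

/-- **`P(n) = P` for `n ∈ P`.** [folklore] -/
theorem sup_adjoin_simple_eq_of_mem (P : IntermediateField ℚ ℂ) {n : ℂ} (hn : n ∈ P) : P ⊔ ℚ⟮n⟯ = P :=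
  sup_eq_left.2 (adjoin_simple_le_iff.2 hn)

end FieldLemma

/-! ## §2 Number fields: `[M N : ℚ] ∈ {[M N⁺ : ℚ], 2 [M N⁺ : ℚ]}` and the criterion -/

section Criterion

variable {I : Type} {K : I → Type} [∀ i, Field (K i)] [∀ i, NumberField (K i)] [∀ i, IsCMField (K i)]

omit [∀ i, IsCMField (K i)] in
/-- The image of an embedding of a number field is finite over `ℚ`. [folklore] -/
private theorem finiteDimensional_fieldRange₄₈' {i : I} (s : K i →+* ℂ) :
    FiniteDimensional ℚ s.toRatAlgHom.fieldRange :=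
  LinearEquiv.finiteDimensional (AlgEquiv.ofInjectiveField s.toRatAlgHom).toLinearEquiv

omit [∀ i, IsCMField (K i)] in
/-- The image `y₀(K⁺)` of the maximal real subfield is finite over `ℚ`. [folklore] -/
private theorem finiteDimensional_realRange₄₈' {i : I} (s : K i →+* ℂ) :
    FiniteDimensional ℚ (s.comp (maximalRealSubfield (K i)).subtype).toRatAlgHom.fieldRange :=
  LinearEquiv.finiteDimensional
    (AlgEquiv.ofInjectiveField (s.comp (maximalRealSubfield (K i)).subtype).toRatAlgHom).toLinearEquiv

omit [∀ i, IsCMField (K i)] in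
/-- `y₀(K⁺) ≤ y₀(K)`. [folklore] -/
private theorem realRange_le_fieldRange {i : I} (s : K i →+* ℂ) :
    (s.comp (maximalRealSubfield (K i)).subtype).toRatAlgHom.fieldRange ≤ s.toRatAlgHom.fieldRange := by
  intro z hz
  obtain ⟨⟨r, hr⟩, rfl⟩ := AlgHom.mem_fieldRange.1 hz
  exact AlgHom.mem_fieldRange.2 ⟨r, rfl⟩

omit [∀ i, IsCMField (K i)] in
/-- For a PRIMITIVE element `α` of `K_b`: `y₀(K_b) = ℚ(y₀ α)`. [cite: Lang2002, V §4 Thm. 4.6] -/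
private theorem fieldRange_eq_adjoin_of_primitive {b : I} (y₀ : K b →+* ℂ) {α : K b} (hα : ℚ⟮α⟯ = ⊤) :
    y₀.toRatAlgHom.fieldRange = ℚ⟮y₀ α⟯ := by
  rw [AlgHom.fieldRange_eq_map, ← hα, adjoin_map, Set.image_singleton]
  rfl

/-- `y₀(r + r̄)`, `y₀(r r̄) ∈ y₀(K⁺)`. [cite: Shimura1998, §18.2 Lemma] -/
private theorem add_conj_mem_realRange' {i : I} (s : K i →+* ℂ) (r : K i) :
    s r + starRingEnd ℂ (s r) ∈ (s.comp (maximalRealSubfield (K i)).subtype).toRatAlgHom.fieldRange ∧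
    s r * starRingEnd ℂ (s r) ∈ (s.comp (maximalRealSubfield (K i)).subtype).toRatAlgHom.fieldRange := by
  have hc : ∀ w : K i, starRingEnd ℂ (s w) = s (IsCMField.complexConj (K i) w) := fun w =>
    (IsCMField.complexEmbedding_complexConj (K i) s w).symm
  have h1 : r + IsCMField.complexConj (K i) r ∈ maximalRealSubfield (K i) := by
    rw [mem_maximalRealSubfield_iff]
    intro φ
    rw [map_add, IsCMField.complexEmbedding_complexConj (K i) φ r, star_add, RCLike.star_def, starRingEnd_self_apply,
      add_comm]
  have h2 : r * IsCMField.complexConj (K i) r ∈ maximalRealSubfield (K i) := by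
    rw [mem_maximalRealSubfield_iff]
    intro φ
    rw [map_mul, IsCMField.complexEmbedding_complexConj (K i) φ r, star_mul, RCLike.star_def, starRingEnd_self_apply]
  refine ⟨AlgHom.mem_fieldRange.2 ⟨⟨_, h1⟩, ?_⟩, AlgHom.mem_fieldRange.2 ⟨⟨_, h2⟩, ?_⟩⟩
  · change s (r + IsCMField.complexConj (K i) r) = _
    rw [map_add, hc]
  · change s (r * IsCMField.complexConj (K i) r) = _
    rw [map_mul, hc]

omit [∀ i, IsCMField (K i)] in
/-- **`N ≤ M N⁺` ⟹ `M N = M N⁺`** (`M = x(K_a)`, `N = y₀(K_b)`, `N⁺ = y₀(K_b⁺) ≤ N`). [cite: Lang2002, VI §1 Thm. 1.12] -/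
theorem sup_fieldRange_eq_of_le {a b : I} (x : K a →+* ℂ) (y₀ : K b →+* ℂ)
    (hle : y₀.toRatAlgHom.fieldRange ≤
      x.toRatAlgHom.fieldRange ⊔ (y₀.comp (maximalRealSubfield (K b)).subtype).toRatAlgHom.fieldRange) :
    x.toRatAlgHom.fieldRange ⊔ y₀.toRatAlgHom.fieldRange =
      x.toRatAlgHom.fieldRange ⊔ (y₀.comp (maximalRealSubfield (K b)).subtype).toRatAlgHom.fieldRange :=
  le_antisymm (sup_le le_sup_left hle) (sup_le_sup_left (realRange_le_fieldRange y₀) _)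

/-- **`N ⊄ M N⁺` ⟹ `[M N : ℚ] = 2 [M N⁺ : ℚ]`** (with a primitive element `α` of `K_b`: `M N = (M N⁺)(y₀ α)` and
`y₀ α` is quadratic over `M N⁺ ∌ y₀ α`). [cite: Lang2002, V §1 Prop. 1.2 and V §4 Thm. 4.6] -/
theorem finrank_sup_fieldRange_eq_two_mul_of_not_le {a b : I} (x : K a →+* ℂ) (y₀ : K b →+* ℂ)
    (h : ¬ y₀.toRatAlgHom.fieldRange ≤
      x.toRatAlgHom.fieldRange ⊔ (y₀.comp (maximalRealSubfield (K b)).subtype).toRatAlgHom.fieldRange) :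
    finrank ℚ ↥(x.toRatAlgHom.fieldRange ⊔ y₀.toRatAlgHom.fieldRange) =
      2 * finrank ℚ ↥(x.toRatAlgHom.fieldRange ⊔
        (y₀.comp (maximalRealSubfield (K b)).subtype).toRatAlgHom.fieldRange) := by
  set M : IntermediateField ℚ ℂ := x.toRatAlgHom.fieldRange with hM_def
  set R : IntermediateField ℚ ℂ := (y₀.comp (maximalRealSubfield (K b)).subtype).toRatAlgHom.fieldRange
    with hR_def
  haveI : FiniteDimensional ℚ M := finiteDimensional_fieldRange₄₈' x
  haveI : FiniteDimensional ℚ R := finiteDimensional_realRange₄₈' y₀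
  haveI : FiniteDimensional ℚ (M ⊔ R : IntermediateField ℚ ℂ) := IntermediateField.finiteDimensional_sup M R
  obtain ⟨α, hα⟩ := Field.exists_primitive_element ℚ (K b)
  have hN : y₀.toRatAlgHom.fieldRange = ℚ⟮y₀ α⟯ := fieldRange_eq_adjoin_of_primitive y₀ hα
  have hn : y₀ α ∉ M ⊔ R := fun hmem => h (by rw [hN]; exact adjoin_simple_le_iff.2 hmem)
  obtain ⟨hs, hp⟩ := add_conj_mem_realRange' y₀ α
  have hRN : R ≤ ℚ⟮y₀ α⟯ := hN ▸ realRange_le_fieldRange y₀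
  have hMN : M ⊔ y₀.toRatAlgHom.fieldRange = (M ⊔ R) ⊔ ℚ⟮y₀ α⟯ := by
    rw [hN, sup_assoc, sup_eq_right.2 hRN]
  rw [hMN]
  exact finrank_sup_adjoin_simple_eq_two_mul (M ⊔ R) (le_sup_right (a := M) hs) (le_sup_right (a := M) hp) hn

/-- **The dichotomy `[M N : ℚ] ∈ {[M N⁺ : ℚ], 2 [M N⁺ : ℚ]}`** for the composita of `x(K_a)` with `y₀(K_b)` and with
`y₀(K_b⁺)`. [cite: Lang2002, V §1 Prop. 1.2 and VI §1 Thm. 1.12] -/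
theorem finrank_compositum_eq_or {a b : I} (x : K a →+* ℂ) (y₀ : K b →+* ℂ) :
    finrank ℚ ↥(x.toRatAlgHom.fieldRange ⊔ y₀.toRatAlgHom.fieldRange) =
        finrank ℚ ↥(x.toRatAlgHom.fieldRange ⊔
          (y₀.comp (maximalRealSubfield (K b)).subtype).toRatAlgHom.fieldRange) ∨
      finrank ℚ ↥(x.toRatAlgHom.fieldRange ⊔ y₀.toRatAlgHom.fieldRange) =
        2 * finrank ℚ ↥(x.toRatAlgHom.fieldRange ⊔
          (y₀.comp (maximalRealSubfield (K b)).subtype).toRatAlgHom.fieldRange) := by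
  by_cases hle : y₀.toRatAlgHom.fieldRange ≤
      x.toRatAlgHom.fieldRange ⊔ (y₀.comp (maximalRealSubfield (K b)).subtype).toRatAlgHom.fieldRange
  · exact Or.inl (by rw [sup_fieldRange_eq_of_le x y₀ hle])
  · exact Or.inr (finrank_sup_fieldRange_eq_two_mul_of_not_le x y₀ hle)

/-- **The degree criterion.**  `∃ σ ∈ Aut(ℂ), σ ∘ x = x̄ ∧ σ ∘ y₀ = y₀` **iff**
`[x(K_a) y₀(K_b) : ℚ] = 2 · [x(K_a) y₀(K_b⁺) : ℚ]`. [cite: Lang2002, V §2 Thm. 2.8 and VI §1 Thm. 1.12] -/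
theorem exists_conj_smul_iff_finrank_eq_two_mul {a b : I} (x : K a →+* ℂ) (y₀ : K b →+* ℂ) :
    (∃ σ : ℂ ≃+* ℂ, σ • x = (starRingAut : ℂ ≃+* ℂ) • x ∧ σ • y₀ = y₀) ↔
    finrank ℚ ↥(x.toRatAlgHom.fieldRange ⊔ y₀.toRatAlgHom.fieldRange) =
      2 * finrank ℚ ↥(x.toRatAlgHom.fieldRange ⊔
        (y₀.comp (maximalRealSubfield (K b)).subtype).toRatAlgHom.fieldRange) := by
  rw [exists_conj_smul_iff_not_le x y₀]
  refine ⟨finrank_sup_fieldRange_eq_two_mul_of_not_le x y₀, fun h2 hle => ?_⟩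
  haveI : FiniteDimensional ℚ (x.toRatAlgHom.fieldRange) := finiteDimensional_fieldRange₄₈' x
  haveI : FiniteDimensional ℚ (y₀.comp (maximalRealSubfield (K b)).subtype).toRatAlgHom.fieldRange :=
    finiteDimensional_realRange₄₈' y₀
  haveI : FiniteDimensional ℚ ↥(x.toRatAlgHom.fieldRange ⊔
      (y₀.comp (maximalRealSubfield (K b)).subtype).toRatAlgHom.fieldRange) :=
    IntermediateField.finiteDimensional_sup _ _
  rw [sup_fieldRange_eq_of_le x y₀ hle] at h2
  have hpos := Module.finrank_pos (R := ℚ) (M := ↥(x.toRatAlgHom.fieldRange ⊔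
      (y₀.comp (maximalRealSubfield (K b)).subtype).toRatAlgHom.fieldRange))
  omega

/-- **(PC) in degree form**: every pair of embeddings admits a pointwise partial conjugation iff
`[x(K_a) y₀(K_b) : ℚ] = 2 [x(K_a) y₀(K_b⁺) : ℚ]` for every conjugate `x(K_a)` (one base point `y₀`).
[cite: Lang2002, V §2 Thm. 2.8 and VI §1 Thm. 1.12] -/
theorem pointwiseConj_iff_forall_finrank_eq_two_mul {a b : I} (y₀ : K b →+* ℂ) :
    (∀ (x : K a →+* ℂ) (y : K b →+* ℂ), ∃ σ : ℂ ≃+* ℂ, σ • x = (starRingAut : ℂ ≃+* ℂ) • x ∧ σ • y = y) ↔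
    ∀ x : K a →+* ℂ, finrank ℚ ↥(x.toRatAlgHom.fieldRange ⊔ y₀.toRatAlgHom.fieldRange) =
      2 * finrank ℚ ↥(x.toRatAlgHom.fieldRange ⊔
        (y₀.comp (maximalRealSubfield (K b)).subtype).toRatAlgHom.fieldRange) :=
  ⟨fun h x => (exists_conj_smul_iff_finrank_eq_two_mul x y₀).1 (h x y₀),
    fun h => pointwiseConj_of_basePoint y₀ fun x => (exists_conj_smul_iff_finrank_eq_two_mul x y₀).2 (h x)⟩

omit [∀ i, IsCMField (K i)] in
/-- `[x(K) : ℚ] = [K : ℚ]`. [folklore] -/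
private theorem finrank_fieldRange_eq {i : I} (s : K i →+* ℂ) :
    finrank ℚ ↥s.toRatAlgHom.fieldRange = finrank ℚ (K i) :=
  ((AlgEquiv.ofInjectiveField s.toRatAlgHom).toLinearEquiv.finrank_eq).symm

/-- `2 [y₀(K⁺) : ℚ] = [K : ℚ]` for a CM field `K`. [cite: Shimura1998, §18.2 Lemma] -/
private theorem two_mul_finrank_realRange_eq {i : I} (s : K i →+* ℂ) :
    2 * finrank ℚ ↥(s.comp (maximalRealSubfield (K i)).subtype).toRatAlgHom.fieldRange = finrank ℚ (K i) := by
  have h1 : finrank ℚ ↥(s.comp (maximalRealSubfield (K i)).subtype).toRatAlgHom.fieldRange =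
      finrank ℚ (maximalRealSubfield (K i)) :=
    ((AlgEquiv.ofInjectiveField (s.comp (maximalRealSubfield (K i)).subtype).toRatAlgHom).toLinearEquiv.finrank_eq).symm
  rw [h1, ← Module.finrank_mul_finrank ℚ (maximalRealSubfield (K i)) (K i),
    Algebra.IsQuadraticExtension.finrank_eq_two (maximalRealSubfield (K i)) (K i), mul_comm]

/-- **A LARGE compositum forces a pointwise partial conjugation**: if `[x(K_a) y₀(K_b) : ℚ] > [K_a : ℚ][K_b : ℚ]/2`
then `∃ σ ∈ Aut(ℂ), σ ∘ x = x̄ ∧ σ ∘ y₀ = y₀` (the alternative `[M N : ℚ] = [M N⁺ : ℚ] ≤ [K_a : ℚ][K_b⁺ : ℚ]` is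
excluded).  Linear disjointness (`[M N : ℚ] = [K_a : ℚ][K_b : ℚ]`) is the extreme case; every degree strictly above
half the product suffices. [cite: Lang2002, VI §1 Thm. 1.12 and Cor. 1.13] -/
theorem exists_conj_smul_of_lt_two_mul_finrank_sup {a b : I} (x : K a →+* ℂ) (y₀ : K b →+* ℂ)
    (h : finrank ℚ (K a) * finrank ℚ (K b) < 2 * finrank ℚ ↥(x.toRatAlgHom.fieldRange ⊔ y₀.toRatAlgHom.fieldRange)) :
    ∃ σ : ℂ ≃+* ℂ, σ • x = (starRingAut : ℂ ≃+* ℂ) • x ∧ σ • y₀ = y₀ := by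
  rw [exists_conj_smul_iff_finrank_eq_two_mul]
  rcases finrank_compositum_eq_or x y₀ with h1 | h2
  · exfalso
    have h3 := IntermediateField.finrank_sup_le x.toRatAlgHom.fieldRange
      (y₀.comp (maximalRealSubfield (K b)).subtype).toRatAlgHom.fieldRange
    rw [finrank_fieldRange_eq, ← h1] at h3
    have h4 := two_mul_finrank_realRange_eq y₀
    have h5 : 2 * finrank ℚ ↥(x.toRatAlgHom.fieldRange ⊔ y₀.toRatAlgHom.fieldRange) ≤
        finrank ℚ (K a) * (2 * finrank ℚ ↥(y₀.comp (maximalRealSubfield (K b)).subtype).toRatAlgHom.fieldRange) := by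
      nlinarith [h3]
    rw [h4] at h5
    omega
  · exact h2

end Criterion

/-! ## §3 Consequences: common constituents, nondegeneracy, the Hodge conjecture on `A_a^m × A_b^n` -/

section Consequences

variable {I : Type} {K : I → Type} [∀ i, Field (K i)] [∀ i, NumberField (K i)] [∀ i, IsCMField (K i)]

/-- **`[x(K_a) y₀(K_b) : ℚ] = 2 [x(K_a) y₀(K_b⁺) : ℚ]` for all `x` ⟹ no common constituent** (both orders, all types).
[cite: Gordon1999HodgeAVSurvey, §3 Theorem (proof)] -/
theorem pairwise_of_forall_finrank_eq_two_mul (Φ : ∀ i, CMType (K i)) {a b : I} (y₀ : K b →+* ℂ)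
    (h : ∀ x : K a →+* ℂ, finrank ℚ ↥(x.toRatAlgHom.fieldRange ⊔ y₀.toRatAlgHom.fieldRange) =
      2 * finrank ℚ ↥(x.toRatAlgHom.fieldRange ⊔
        (y₀.comp (maximalRealSubfield (K b)).subtype).toRatAlgHom.fieldRange)) :
    (∀ P : Submodule ℚ ((K a →+* ℂ) → ℚ), P ≤ antiSpan (ℂ ≃+* ℂ) (Φ a).1 →
      (∀ g : ℂ ≃+* ℂ, ∀ f ∈ P, (fun x => f (g • x)) ∈ P) →
      ∀ T : ((K a →+* ℂ) → ℚ) →ₗ[ℚ] ((K b →+* ℂ) → ℚ),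
        (∀ g : ℂ ≃+* ℂ, ∀ f ∈ P, T (fun x => f (g • x)) = fun y => T f (g • y)) →
        (∀ f ∈ P, T f ∈ antiSpan (ℂ ≃+* ℂ) (Φ b).1) → (∀ f ∈ P, T f = 0 → f = 0) → P = ⊥) ∧
    (∀ P : Submodule ℚ ((K b →+* ℂ) → ℚ), P ≤ antiSpan (ℂ ≃+* ℂ) (Φ b).1 →
      (∀ g : ℂ ≃+* ℂ, ∀ f ∈ P, (fun x => f (g • x)) ∈ P) →
      ∀ T : ((K b →+* ℂ) → ℚ) →ₗ[ℚ] ((K a →+* ℂ) → ℚ),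
        (∀ g : ℂ ≃+* ℂ, ∀ f ∈ P, T (fun x => f (g • x)) = fun y => T f (g • y)) →
        (∀ f ∈ P, T f ∈ antiSpan (ℂ ≃+* ℂ) (Φ a).1) → (∀ f ∈ P, T f = 0 → f = 0) → P = ⊥) :=
  pairwise_of_pointwiseConj_basePoint Φ y₀ fun x => (exists_conj_smul_iff_finrank_eq_two_mul x y₀).2 (h x)

variable [Fintype I] [DecidableEq I]

/-- **Two slots under the degree condition: nondegenerate iff both members are** (all CM types).
[cite: Gordon1999HodgeAVSurvey, §3 Theorem and 7.5] -/
theorem isNondegenerateFamily_iff_pair_of_forall_finrank_eq_two_mul {i₀ i₁ : I} (h01 : i₀ ≠ i₁)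
    (hI : ∀ j, j = i₀ ∨ j = i₁) (Φ : ∀ i, CMType (K i)) (y₀ : K i₁ →+* ℂ)
    (h : ∀ x : K i₀ →+* ℂ, finrank ℚ ↥(x.toRatAlgHom.fieldRange ⊔ y₀.toRatAlgHom.fieldRange) =
      2 * finrank ℚ ↥(x.toRatAlgHom.fieldRange ⊔
        (y₀.comp (maximalRealSubfield (K i₁)).subtype).toRatAlgHom.fieldRange)) :
    CMAlgebra.IsNondegenerateFamily Φ ↔ ∀ i, IsNondegenerate (Φ i) :=
  isNondegenerateFamily_iff_pair_of_pointwiseConj h01 hI Φ y₀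
    fun x => (exists_conj_smul_iff_finrank_eq_two_mul x y₀).2 (h x)

/-- **Two slots under the degree condition: `rank(Φ_{i₀}, Φ_{i₁}) + 2 = rank Φ_{i₀} + rank Φ_{i₁} + 1`**
(`Hg(A₀ × A₁) = Hg(A₀) × Hg(A₁)`, all CM types). [cite: Gordon1999HodgeAVSurvey, §3 Theorem (1)] -/
theorem cmFamilyRank_add_card_eq_pair_of_forall_finrank_eq_two_mul {i₀ i₁ : I} (h01 : i₀ ≠ i₁)
    (hI : ∀ j, j = i₀ ∨ j = i₁) (Φ : ∀ i, CMType (K i)) (y₀ : K i₁ →+* ℂ)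
    (h : ∀ x : K i₀ →+* ℂ, finrank ℚ ↥(x.toRatAlgHom.fieldRange ⊔ y₀.toRatAlgHom.fieldRange) =
      2 * finrank ℚ ↥(x.toRatAlgHom.fieldRange ⊔
        (y₀.comp (maximalRealSubfield (K i₁)).subtype).toRatAlgHom.fieldRange)) :
    CMAlgebra.cmFamilyRank Φ + Fintype.card I = (∑ i, cmTypeRank (Φ i)) + 1 :=
  cmFamilyRank_add_card_eq_pair_of_pointwiseConj h01 hI Φ y₀
    fun x => (exists_conj_smul_iff_finrank_eq_two_mul x y₀).2 (h x)

variable {Φ : ∀ i, CMType (K i)} {A : I → AbelianVariety ℂ} {ι : ∀ i, 𝓞 (K i) →+* End (A i)}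
  {θ : ∀ i, K i →+* Module.End ℂ (complexBetti (A i).X 1)}

/-- **Two CM abelian varieties of nondegenerate types whose fields satisfy the degree condition**
(`[x(K_{i₀}) y₀(K_{i₁}) : ℚ] = 2 [x(K_{i₀}) y₀(K_{i₁}⁺) : ℚ]` for every `x`): the Hodge conjecture and `B• = D•` on EVERY
`A₀^m × A₁^n`, UNCONDITIONALLY. [cite: Gordon1999HodgeAVSurvey, §3 Theorem, 7.5 and 10.10] -/
theorem hodgeConjectureFor_prod_pair_of_forall_finrank_eq_two_mul {i₀ i₁ : I} (h01 : i₀ ≠ i₁)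
    (hI : ∀ j, j = i₀ ∨ j = i₁) (y₀ : K i₁ →+* ℂ)
    (h : ∀ x : K i₀ →+* ℂ, finrank ℚ ↥(x.toRatAlgHom.fieldRange ⊔ y₀.toRatAlgHom.fieldRange) =
      2 * finrank ℚ ↥(x.toRatAlgHom.fieldRange ⊔
        (y₀.comp (maximalRealSubfield (K i₁)).subtype).toRatAlgHom.fieldRange))
    (hΦ : ∀ i, IsNondegenerate (Φ i)) (hA : ∀ i, IsCMTypeRealisation (Φ i) (A i) (ι i) (θ i)) {N : ℕ}
    (π : Fin N → I) :
    HodgeConjectureFor (⨁ fun j : Fin N => A (π j)).dim (⨁ fun j : Fin N => A (π j)).X ∧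
      ∀ m : ℕ, hodgeClassSpan (⨁ fun j : Fin N => A (π j)).dim (⨁ fun j : Fin N => A (π j)).X m =
        divisorClassesSpan (⨁ fun j : Fin N => A (π j)).X (⨁ fun j : Fin N => A (π j)).dim m :=
  hodgeConjectureFor_prod_pair_of_pointwiseConj h01 hI y₀
    (fun x => (exists_conj_smul_iff_finrank_eq_two_mul x y₀).2 (h x)) hΦ hA π

/-- **(PC) by degrees on every pair of slots of a family: nondegenerate iff every member is.**
[cite: Gordon1999HodgeAVSurvey, §3 Theorem and 7.5] -/
theorem isNondegenerateFamily_iff_of_forall_finrank_eq_two_mul [Nonempty I] (Φ : ∀ i, CMType (K i))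
    (h : ∀ i j, i ≠ j → ∀ (x : K i →+* ℂ) (y : K j →+* ℂ),
      finrank ℚ ↥(x.toRatAlgHom.fieldRange ⊔ y.toRatAlgHom.fieldRange) =
        2 * finrank ℚ ↥(x.toRatAlgHom.fieldRange ⊔
          (y.comp (maximalRealSubfield (K j)).subtype).toRatAlgHom.fieldRange)) :
    CMAlgebra.IsNondegenerateFamily Φ ↔ ∀ i, IsNondegenerate (Φ i) :=
  isNondegenerateFamily_iff_of_forall_pointwiseConj Φ fun i j hij x y =>
    (exists_conj_smul_iff_finrank_eq_two_mul x y).2 (h i j hij x y)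

/-- **(PC) by degrees on every pair and nondegenerate members: the Hodge conjecture and `B• = D•` on EVERY
`∏_i A_i^{k_i}`**, UNCONDITIONALLY. [cite: Gordon1999HodgeAVSurvey, §3 Theorem, 7.5 and 10.10] -/
theorem hodgeConjectureFor_prod_of_forall_finrank_eq_two_mul [Nonempty I]
    (h : ∀ i j, i ≠ j → ∀ (x : K i →+* ℂ) (y : K j →+* ℂ),
      finrank ℚ ↥(x.toRatAlgHom.fieldRange ⊔ y.toRatAlgHom.fieldRange) =
        2 * finrank ℚ ↥(x.toRatAlgHom.fieldRange ⊔
          (y.comp (maximalRealSubfield (K j)).subtype).toRatAlgHom.fieldRange))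
    (hΦ : ∀ i, IsNondegenerate (Φ i)) (hA : ∀ i, IsCMTypeRealisation (Φ i) (A i) (ι i) (θ i)) {N : ℕ}
    (π : Fin N → I) :
    HodgeConjectureFor (⨁ fun j : Fin N => A (π j)).dim (⨁ fun j : Fin N => A (π j)).X ∧
      ∀ m : ℕ, hodgeClassSpan (⨁ fun j : Fin N => A (π j)).dim (⨁ fun j : Fin N => A (π j)).X m =
        divisorClassesSpan (⨁ fun j : Fin N => A (π j)).X (⨁ fun j : Fin N => A (π j)).dim m :=
  hodgeConjectureFor_prod_of_forall_pointwiseConj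
    (fun i j hij x y => (exists_conj_smul_iff_finrank_eq_two_mul x y).2 (h i j hij x y)) hΦ hA π

/-- **Two CM abelian varieties of nondegenerate types with LARGE composita** (`[x(K_{i₀}) y₀(K_{i₁}) : ℚ] >
[K_{i₀} : ℚ][K_{i₁} : ℚ]/2` for every `x`): the Hodge conjecture and `B• = D•` on EVERY `A₀^m × A₁^n`, UNCONDITIONALLY.
[cite: Gordon1999HodgeAVSurvey, §3 Theorem, 7.5 and 10.10] [cite: Lang2002, VI §1 Thm. 1.12] -/
theorem hodgeConjectureFor_prod_pair_of_forall_lt_two_mul_finrank_sup {i₀ i₁ : I} (h01 : i₀ ≠ i₁)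
    (hI : ∀ j, j = i₀ ∨ j = i₁) (y₀ : K i₁ →+* ℂ)
    (h : ∀ x : K i₀ →+* ℂ, finrank ℚ (K i₀) * finrank ℚ (K i₁) <
      2 * finrank ℚ ↥(x.toRatAlgHom.fieldRange ⊔ y₀.toRatAlgHom.fieldRange))
    (hΦ : ∀ i, IsNondegenerate (Φ i)) (hA : ∀ i, IsCMTypeRealisation (Φ i) (A i) (ι i) (θ i)) {N : ℕ}
    (π : Fin N → I) :
    HodgeConjectureFor (⨁ fun j : Fin N => A (π j)).dim (⨁ fun j : Fin N => A (π j)).X ∧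
      ∀ m : ℕ, hodgeClassSpan (⨁ fun j : Fin N => A (π j)).dim (⨁ fun j : Fin N => A (π j)).X m =
        divisorClassesSpan (⨁ fun j : Fin N => A (π j)).X (⨁ fun j : Fin N => A (π j)).dim m :=
  hodgeConjectureFor_prod_pair_of_pointwiseConj h01 hI y₀
    (fun x => exists_conj_smul_of_lt_two_mul_finrank_sup x y₀ (h x)) hΦ hA π

/-- **Two slots with large composita: nondegenerate iff both members are** (all CM types).
[cite: Gordon1999HodgeAVSurvey, §3 Theorem and 7.5] [cite: Lang2002, VI §1 Thm. 1.12] -/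
theorem isNondegenerateFamily_iff_pair_of_forall_lt_two_mul_finrank_sup {i₀ i₁ : I} (h01 : i₀ ≠ i₁)
    (hI : ∀ j, j = i₀ ∨ j = i₁) (Φ : ∀ i, CMType (K i)) (y₀ : K i₁ →+* ℂ)
    (h : ∀ x : K i₀ →+* ℂ, finrank ℚ (K i₀) * finrank ℚ (K i₁) <
      2 * finrank ℚ ↥(x.toRatAlgHom.fieldRange ⊔ y₀.toRatAlgHom.fieldRange)) :
    CMAlgebra.IsNondegenerateFamily Φ ↔ ∀ i, IsNondegenerate (Φ i) :=
  isNondegenerateFamily_iff_pair_of_pointwiseConj h01 hI Φ y₀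
    fun x => exists_conj_smul_of_lt_two_mul_finrank_sup x y₀ (h x)

omit [Fintype I] [DecidableEq I] in
/-- **The decision procedure by degrees, nondegenerate types**: the slots `a → b` have no common constituent **iff**
`[x(K_a) y₀(K_b) : ℚ] = 2 [x(K_a) y₀(K_b⁺) : ℚ]` for every conjugate `x(K_a)`.
[cite: Gordon1999HodgeAVSurvey, §3 Theorem and 7.5] [cite: Lang2002, VI §1 Thm. 1.12] -/
theorem pairwise_iff_forall_finrank_eq_two_mul (Φ : ∀ i, CMType (K i)) {a b : I} (ha : IsNondegenerate (Φ a))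
    (hb : IsNondegenerate (Φ b)) (y₀ : K b →+* ℂ) :
    (∀ P : Submodule ℚ ((K a →+* ℂ) → ℚ), P ≤ antiSpan (ℂ ≃+* ℂ) (Φ a).1 →
      (∀ g : ℂ ≃+* ℂ, ∀ f ∈ P, (fun x => f (g • x)) ∈ P) →
      ∀ T : ((K a →+* ℂ) → ℚ) →ₗ[ℚ] ((K b →+* ℂ) → ℚ),
        (∀ g : ℂ ≃+* ℂ, ∀ f ∈ P, T (fun x => f (g • x)) = fun y => T f (g • y)) →
        (∀ f ∈ P, T f ∈ antiSpan (ℂ ≃+* ℂ) (Φ b).1) → (∀ f ∈ P, T f = 0 → f = 0) → P = ⊥) ↔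
    ∀ x : K a →+* ℂ, finrank ℚ ↥(x.toRatAlgHom.fieldRange ⊔ y₀.toRatAlgHom.fieldRange) =
      2 * finrank ℚ ↥(x.toRatAlgHom.fieldRange ⊔
        (y₀.comp (maximalRealSubfield (K b)).subtype).toRatAlgHom.fieldRange) := by
  rw [pairwise_iff_pointwiseConj_basePoint Φ ha hb y₀]
  exact forall_congr' fun x => exists_conj_smul_iff_finrank_eq_two_mul x y₀

end Consequences

end Summit.HodgeConjecture.CorCM

end
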